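/-
Copyright (c) 2026. All rights reserved.
Released under Apache 2.0 license as described in the file LICENSE.
Authors: abc-iut cell, IUT REPAIR / RESCUE-H prover seat abc-iut-rp-d4 (gen 4).
-/
import Literature.IUT.LogVolume.UnitLogValuationProfileCosets
import Literature.IUT.LogVolume.UnitLogPrincipalRoots
import HarnessLib

/-!
# The VALUATION PROFILE of `log_p(𝒪_K^×)`, VII: on a properly-met sphere the cell `q ∈ qⁿ·ℐ_K` is REALISED
# BOTH WAYS by elements of the same norm — it is NOT a function of `‖q‖`

PROOF-ONLY sequel (no `def`, no named fact) of `UnitLogValuationProfile{,Shell,Cosets}.lean` and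
`UnitLogPrincipalRoots.lean` (abc-iut cell, D-0079 RESCUE-H «local-height condition I06⋆»; R-H table of record
`plan/rescue/R-H/I06STAR-COLUMNS.tsv`, the col-42 «OPEN-element» cells of the CHOSEN-IDELE bed).  Same setting: `K` a
proper ultrametric normed `ℚ_p`-algebra, `e = absRamificationIdx p K`, `ϖ` a norm uniformizer, `L = log_p(𝒪_K^×)`,
`ℐ_K = (p*)⁻¹·L` ([AbsTopIII] Def. 5.4 (iii), `logShell_ofUnitLog`), `ν(s) = s·p^{a₀} − e·a₀` (`a₀` the STRICT turning
point of `s`), and the cell exponent `t := e·ord_p(p*) − m·(n − 1)` of `p*·q^{1−n}` for `‖q‖ = ‖ϖ‖ᵐ`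
(`norm_pstar_mul_eq_zpow`).

Part II decided the cell from `‖q‖` alone off the attained levels (POS `mem_pow_smul_logShell_of_lt`, NEG
`not_mem_pow_smul_logShell_of_gap` / `…_of_lt_min`) and showed the sphere at `t = ν(s)`, `a₀ ≥ 1`, is met properly
(`sphere_meets_not_subset_logUnits`).  Here the remaining cells are settled AS A QUESTION ABOUT `‖q‖`: they are
NOT decided by it, because both verdicts are REALISED by elements of that norm (`p ∤ n − 1`):

* §1 `pstar_mul_pow_inv_mul_eq` — for `q = B·w⁻¹`: `p*·(qⁿ)⁻¹·q = [p*·(Bⁿ)⁻¹·B]·w^{n−1}`.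
* §2 **POS REALISED** `exists_norm_eq_mem_pow_smul_logShell` — at `t = ν(s)` (`s ≥ 1`, strict `a₀ ≥ 0`) there is `q`
  with `‖q‖ = ‖ϖ‖ᵐ` and `q ∈ qⁿ·ℐ_K`: part VI §3 gives `z ∈ L` in the residue class of `A := p*·ϖ^{m(1−n)}`, part
  `PrincipalRoots` writes `z = A·w^{n−1}` (`p ∤ n−1`), and `q := ϖᵐ·w⁻¹` has `p*·q^{1−n} = z`.
* §3 **NEG REALISED** `exists_norm_eq_not_mem_pow_smul_logShell` — `(p − 1) ∤ e`, `t = ν(s)`, `a₀ ≥ 1`: there is `q`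
  with `‖q‖ = ‖ϖ‖ᵐ` and `q ∉ qⁿ·ℐ_K` (part VI §4: a non-log-unit in the class of `A`; same root extraction).
* §4 **THE CELL IS NOT A FUNCTION OF THE NORM** (`cell_realised_both_ways`, `not_exists_decision_of_norm`): under
  `(p − 1) ∤ e`, `p ∤ n − 1`, `t = ν(s)`, `s ≥ 1`, `a₀ ≥ 1`, there is NO proposition `d` with
  `∀ q, ‖q‖ = ‖ϖ‖ᵐ → (q ∈ qⁿ·ℐ_K ↔ d)`.  For a `q` specified ONLY by its norm (abc-iut's CHOSEN realising q-ideles,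
  `Cor312ProvKChosenQIdeleNorm`: a `Classical.choose` over a norm-only specification) these cells are therefore
  undecidable from the specification — the kernel form of the «structural ceiling» of the chosen-idele bed recorded
  by abc-iut-H-num-1 (R-H SEMANTICS FINDING) and abc-iut-rh-num-1 (col 42).  Cells with `p ∣ n − 1` are not treated.

Classical `p`-adic analysis; nothing here is disputed mathematics; no IUT statement is asserted (`logUnits`/`logShell`
are the cell's typings of [IUTchIV] Prop. 1.2's `log_p(R^×)` / [AbsTopIII] Def. 5.4 (iii)'s `ℐ_k`,
[claim: Mochizuki2012, status: disputed] for those locutions only); no side taken on [IUTchIII] Cor. 3.12 or on any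
author.  References: [cite: NeukirchANT1999, Ch. II Prop. (5.5), (5.7), (5.8)] [cite: MochizukiAbsTopIII2015, Def 5.4 (iii) p. 126].
-/

noncomputable section

open Metric Set
open scoped Pointwise

namespace Literature.IUT.LogVolume

namespace ValuationProfile

open Literature.NumberTheory.GaloisRepresentations.Ultrametric RamificationCriterion
  Literature.AnabelianGeometry.AbsoluteAnabelian

section Realisable

variable (p : ℕ) [hp : Fact p.Prime]
variable {K : Type*} [NontriviallyNormedField K] [instK : NormedAlgebra ℚ_[p] K] [IsUltrametricDist K]
  [ProperSpace K]

/-! ### §1. The cell element of `q = B·w⁻¹` -/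

omit hp instK [IsUltrametricDist K] [ProperSpace K] in
/-- For `q = B·w⁻¹` (`B, w ≠ 0`, `n ≥ 1`): `c·(qⁿ)⁻¹·q = c·(Bⁿ)⁻¹·B·w^{n−1}`. [cite: MochizukiAbsTopIII2015, Def 5.4 (iii) p. 126] -/
theorem pstar_mul_pow_inv_mul_eq (c : K) {B w : K} (hB : B ≠ 0) (hw : w ≠ 0) {n : ℕ} (hn : 1 ≤ n) :
    c * (((B * w⁻¹) ^ n)⁻¹ * (B * w⁻¹)) = c * ((B ^ n)⁻¹ * B) * w ^ (n - 1) := by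
  obtain ⟨k, rfl⟩ := Nat.exists_eq_add_of_le hn
  rw [Nat.add_sub_cancel_left]
  have hBk : B ^ (1 + k) ≠ 0 := pow_ne_zero _ hB
  have hwk : w ^ (1 + k) ≠ 0 := pow_ne_zero _ hw
  simp only [mul_pow, inv_pow, mul_inv, inv_inv]
  field_simp
  ring

/-! ### §2. POS realised at an attained level -/

/-- **POS REALISED.**  At `t = e·ord_p(p*) − m·(n−1) = ν(s)` (`s ≥ 1`, STRICT turning point `a₀`, `p ∤ n − 1`,
`n ≥ 1`) there is `q` with `‖q‖ = ‖ϖ‖ᵐ` and `q ∈ qⁿ·ℐ_K`: a log-unit `z` in the residue class of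
`A = p*·(ϖᵐ)^{1−n}` (part VI `exists_mem_logUnits_norm_sub_lt`) is `A·w^{n−1}` with `w` principal
(`PrincipalRoot.exists_eq_mul_pow_of_norm_sub_lt`), and `q := ϖᵐ·w⁻¹` gives `p*·q^{1−n} = z ∈ L`.
[cite: NeukirchANT1999, Ch. II Prop. (5.5), (5.7), (5.8)] [cite: MochizukiAbsTopIII2015, Def 5.4 (iii) p. 126] -/
theorem exists_norm_eq_mem_pow_smul_logShell {ϖ : Kˣ} (hϖ : IsUniformizer ϖ) {m : ℤ} {n : ℕ} (hn : 1 ≤ n)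
    (hpn : ¬ p ∣ (n - 1)) {s : ℕ} (hs : 1 ≤ s) {a₀ : ℕ}
    (hlo : ∀ a < a₀, (s : ℤ) * (p : ℤ) ^ a * ((p : ℤ) - 1) < absRamificationIdx p K)
    (hhi : (absRamificationIdx p K : ℤ) < (s : ℤ) * (p : ℤ) ^ a₀ * ((p : ℤ) - 1))
    (ht : (absRamificationIdx p K : ℤ) * ((if p = 2 then 2 else 1 : ℕ) : ℤ) - m * ((n : ℤ) - 1) =
      (s : ℤ) * (p : ℤ) ^ a₀ - (absRamificationIdx p K : ℤ) * (a₀ : ℤ)) :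
    ∃ q : K, ‖q‖ = ‖(ϖ : K)‖ ^ m ∧
      q ∈ q ^ n • Literature.AnabelianGeometry.AbsoluteAnabelian.logShell (PadicLogOnUnits.ofUnitLog p K) := by
  have hw0 : (ϖ : K) ≠ 0 := ϖ.ne_zero
  set B : K := (ϖ : K) ^ m with hB
  have hB0 : B ≠ 0 := zpow_ne_zero m hw0
  have hBn : ‖B‖ = ‖(ϖ : K)‖ ^ m := norm_zpow _ _
  set A : K := ((p ^ (if p = 2 then 2 else 1) : ℕ) : K) * ((B ^ n)⁻¹ * B) with hA_def
  have hA : ‖A‖ = ‖(ϖ : K)‖ ^ ((s : ℤ) * (p : ℤ) ^ a₀ - (absRamificationIdx p K : ℤ) * (a₀ : ℤ)) := by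
    rw [hA_def, norm_pstar_mul_eq_zpow p hϖ hBn n, ht]
  obtain ⟨z, hzL, hzA⟩ := exists_mem_logUnits_norm_sub_lt p hϖ hs hlo hhi hA
  obtain ⟨w, hwP, hzw⟩ := PrincipalRoot.exists_eq_mul_pow_of_norm_sub_lt p hpn hzA
  have hw1 : ‖w‖ = 1 := hwP.norm_eq_one
  have hwne : w ≠ 0 := norm_pos_iff.mp (by rw [hw1]; exact one_pos)
  have hq0 : B * w⁻¹ ≠ 0 := mul_ne_zero hB0 (inv_ne_zero hwne)
  refine ⟨B * w⁻¹, by rw [norm_mul, norm_inv, hBn, hw1, inv_one, mul_one], ?_⟩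
  rw [mem_pow_smul_logShell_iff p hq0, pstar_mul_pow_inv_mul_eq _ hB0 hwne hn, ← hA_def, ← hzw]
  exact hzL

/-! ### §3. NEG realised at a properly-met level -/

/-- **NEG REALISED** (`(p − 1) ∤ e`).  At `t = e·ord_p(p*) − m·(n−1) = ν(s)` with `a₀ ≥ 1` (`p ∤ n − 1`, `n ≥ 1`)
there is `q` with `‖q‖ = ‖ϖ‖ᵐ` and `q ∉ qⁿ·ℐ_K`: a non-log-unit `z` with `‖z − A‖ ≤ ‖ϖ‖^{t+1} < ‖A‖`,
`A = p*·(ϖᵐ)^{1−n}` (part VI `exists_norm_sub_le_succ_not_mem_logUnits`), is `A·w^{n−1}` with `w` principal, and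
`q := ϖᵐ·w⁻¹` has `p*·q^{1−n} = z ∉ L`. [cite: NeukirchANT1999, Ch. II Prop. (5.5), (5.8)]
[cite: MochizukiAbsTopIII2015, Def 5.4 (iii) p. 126] -/
theorem exists_norm_eq_not_mem_pow_smul_logShell (hnd : ¬ (p - 1) ∣ absRamificationIdx p K) {ϖ : Kˣ}
    (hϖ : IsUniformizer ϖ) {m : ℤ} {n : ℕ} (hn : 1 ≤ n) (hpn : ¬ p ∣ (n - 1)) {s : ℕ} {a₀ : ℕ} (ha₀ : a₀ ≠ 0)
    (hlo : ∀ a < a₀, (s : ℤ) * (p : ℤ) ^ a * ((p : ℤ) - 1) < absRamificationIdx p K)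
    (ht : (absRamificationIdx p K : ℤ) * ((if p = 2 then 2 else 1 : ℕ) : ℤ) - m * ((n : ℤ) - 1) =
      (s : ℤ) * (p : ℤ) ^ a₀ - (absRamificationIdx p K : ℤ) * (a₀ : ℤ)) :
    ∃ q : K, ‖q‖ = ‖(ϖ : K)‖ ^ m ∧
      q ∉ q ^ n • Literature.AnabelianGeometry.AbsoluteAnabelian.logShell (PadicLogOnUnits.ofUnitLog p K) := by
  have hρ0 : 0 < ‖(ϖ : K)‖ := norm_units_pos ϖ
  have hw0 : (ϖ : K) ≠ 0 := ϖ.ne_zero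
  set B : K := (ϖ : K) ^ m with hB
  have hB0 : B ≠ 0 := zpow_ne_zero m hw0
  have hBn : ‖B‖ = ‖(ϖ : K)‖ ^ m := norm_zpow _ _
  set A : K := ((p ^ (if p = 2 then 2 else 1) : ℕ) : K) * ((B ^ n)⁻¹ * B) with hA_def
  have hA : ‖A‖ = ‖(ϖ : K)‖ ^ ((s : ℤ) * (p : ℤ) ^ a₀ - (absRamificationIdx p K : ℤ) * (a₀ : ℤ)) := by
    rw [hA_def, norm_pstar_mul_eq_zpow p hϖ hBn n, ht]
  obtain ⟨z, hzA, hzL⟩ := exists_norm_sub_le_succ_not_mem_logUnits p hnd hϖ ha₀ hlo A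
  have hzA' : ‖z - A‖ < ‖A‖ := by
    rw [hA]
    exact hzA.trans_lt (zpow_lt_zpow_right_of_lt_one₀ hρ0 hϖ.1 (lt_add_one _))
  obtain ⟨w, hwP, hzw⟩ := PrincipalRoot.exists_eq_mul_pow_of_norm_sub_lt p hpn hzA'
  have hw1 : ‖w‖ = 1 := hwP.norm_eq_one
  have hwne : w ≠ 0 := norm_pos_iff.mp (by rw [hw1]; exact one_pos)
  have hq0 : B * w⁻¹ ≠ 0 := mul_ne_zero hB0 (inv_ne_zero hwne)
  refine ⟨B * w⁻¹, by rw [norm_mul, norm_inv, hBn, hw1, inv_one, mul_one], ?_⟩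
  intro hmem
  rw [mem_pow_smul_logShell_iff p hq0, pstar_mul_pow_inv_mul_eq _ hB0 hwne hn, ← hA_def, ← hzw] at hmem
  exact hzL hmem

/-! ### §4. The cell is NOT a function of the norm on a properly-met sphere -/

/-- **BOTH VERDICTS REALISED AT ONE NORM** (`(p − 1) ∤ e`, `p ∤ n − 1`, `n ≥ 1`): at
`t = e·ord_p(p*) − m·(n−1) = ν(s)`, `s ≥ 1`, `a₀ ≥ 1` strict, there are `q₁, q₂` with `‖q₁‖ = ‖q₂‖ = ‖ϖ‖ᵐ`,
`q₁ ∈ q₁ⁿ·ℐ_K` and `q₂ ∉ q₂ⁿ·ℐ_K`. [cite: NeukirchANT1999, Ch. II Prop. (5.5), (5.7), (5.8)]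
[cite: MochizukiAbsTopIII2015, Def 5.4 (iii) p. 126] -/
theorem cell_realised_both_ways (hnd : ¬ (p - 1) ∣ absRamificationIdx p K) {ϖ : Kˣ} (hϖ : IsUniformizer ϖ)
    {m : ℤ} {n : ℕ} (hn : 1 ≤ n) (hpn : ¬ p ∣ (n - 1)) {s : ℕ} (hs : 1 ≤ s) {a₀ : ℕ} (ha₀ : a₀ ≠ 0)
    (hlo : ∀ a < a₀, (s : ℤ) * (p : ℤ) ^ a * ((p : ℤ) - 1) < absRamificationIdx p K)
    (hhi : (absRamificationIdx p K : ℤ) < (s : ℤ) * (p : ℤ) ^ a₀ * ((p : ℤ) - 1))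
    (ht : (absRamificationIdx p K : ℤ) * ((if p = 2 then 2 else 1 : ℕ) : ℤ) - m * ((n : ℤ) - 1) =
      (s : ℤ) * (p : ℤ) ^ a₀ - (absRamificationIdx p K : ℤ) * (a₀ : ℤ)) :
    (∃ q : K, ‖q‖ = ‖(ϖ : K)‖ ^ m ∧
        q ∈ q ^ n • Literature.AnabelianGeometry.AbsoluteAnabelian.logShell (PadicLogOnUnits.ofUnitLog p K)) ∧
      ∃ q : K, ‖q‖ = ‖(ϖ : K)‖ ^ m ∧
        q ∉ q ^ n • Literature.AnabelianGeometry.AbsoluteAnabelian.logShell (PadicLogOnUnits.ofUnitLog p K) :=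
  ⟨exists_norm_eq_mem_pow_smul_logShell p hϖ hn hpn hs hlo hhi ht,
    exists_norm_eq_not_mem_pow_smul_logShell p hnd hϖ hn hpn ha₀ hlo ht⟩

/-- **THE CELL IS UNDECIDABLE FROM THE NORM** (`(p − 1) ∤ e`, `p ∤ n − 1`, `n ≥ 1`, `t = ν(s)`, `s ≥ 1`, `a₀ ≥ 1`):
there is NO proposition `d` such that `q ∈ qⁿ·ℐ_K ↔ d` for every `q` of norm `‖ϖ‖ᵐ`.  An element specified only
by this norm (e.g. a `Classical.choose` over a norm-only specification) cannot have its cell decided from the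
specification. [cite: NeukirchANT1999, Ch. II Prop. (5.5), (5.7), (5.8)] [cite: MochizukiAbsTopIII2015, Def 5.4 (iii) p. 126] -/
theorem not_exists_decision_of_norm (hnd : ¬ (p - 1) ∣ absRamificationIdx p K) {ϖ : Kˣ} (hϖ : IsUniformizer ϖ)
    {m : ℤ} {n : ℕ} (hn : 1 ≤ n) (hpn : ¬ p ∣ (n - 1)) {s : ℕ} (hs : 1 ≤ s) {a₀ : ℕ} (ha₀ : a₀ ≠ 0)
    (hlo : ∀ a < a₀, (s : ℤ) * (p : ℤ) ^ a * ((p : ℤ) - 1) < absRamificationIdx p K)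
    (hhi : (absRamificationIdx p K : ℤ) < (s : ℤ) * (p : ℤ) ^ a₀ * ((p : ℤ) - 1))
    (ht : (absRamificationIdx p K : ℤ) * ((if p = 2 then 2 else 1 : ℕ) : ℤ) - m * ((n : ℤ) - 1) =
      (s : ℤ) * (p : ℤ) ^ a₀ - (absRamificationIdx p K : ℤ) * (a₀ : ℤ)) :
    ¬ ∃ d : Prop, ∀ q : K, ‖q‖ = ‖(ϖ : K)‖ ^ m →
      (q ∈ q ^ n • Literature.AnabelianGeometry.AbsoluteAnabelian.logShell (PadicLogOnUnits.ofUnitLog p K) ↔ d) := by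
  rintro ⟨d, hd⟩
  obtain ⟨⟨q₁, hq₁, h₁⟩, ⟨q₂, hq₂, h₂⟩⟩ := cell_realised_both_ways p hnd hϖ hn hpn hs ha₀ hlo hhi ht
  exact h₂ ((hd q₂ hq₂).mpr ((hd q₁ hq₁).mp h₁))

/-- Norm-relative form: for EVERY `q₀` with `‖q₀‖ = ‖ϖ‖ᵐ` (in particular any element CHOSEN by its norm) there are
`q₁, q₂` OF THE SAME NORM AS `q₀` with `q₁ ∈ q₁ⁿ·ℐ_K` and `q₂ ∉ q₂ⁿ·ℐ_K` (`(p − 1) ∤ e`, `p ∤ n − 1`, `n ≥ 1`,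
`t = ν(s)`, `s ≥ 1`, `a₀ ≥ 1`). [cite: NeukirchANT1999, Ch. II Prop. (5.5), (5.7), (5.8)]
[cite: MochizukiAbsTopIII2015, Def 5.4 (iii) p. 126] -/
theorem exists_same_norm_mem_and_not_mem (hnd : ¬ (p - 1) ∣ absRamificationIdx p K) {ϖ : Kˣ}
    (hϖ : IsUniformizer ϖ) {m : ℤ} {n : ℕ} (hn : 1 ≤ n) (hpn : ¬ p ∣ (n - 1)) {s : ℕ} (hs : 1 ≤ s) {a₀ : ℕ}
    (ha₀ : a₀ ≠ 0) (hlo : ∀ a < a₀, (s : ℤ) * (p : ℤ) ^ a * ((p : ℤ) - 1) < absRamificationIdx p K)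
    (hhi : (absRamificationIdx p K : ℤ) < (s : ℤ) * (p : ℤ) ^ a₀ * ((p : ℤ) - 1))
    (ht : (absRamificationIdx p K : ℤ) * ((if p = 2 then 2 else 1 : ℕ) : ℤ) - m * ((n : ℤ) - 1) =
      (s : ℤ) * (p : ℤ) ^ a₀ - (absRamificationIdx p K : ℤ) * (a₀ : ℤ))
    {q₀ : K} (hq₀ : ‖q₀‖ = ‖(ϖ : K)‖ ^ m) :
    (∃ q : K, ‖q‖ = ‖q₀‖ ∧
        q ∈ q ^ n • Literature.AnabelianGeometry.AbsoluteAnabelian.logShell (PadicLogOnUnits.ofUnitLog p K)) ∧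
      ∃ q : K, ‖q‖ = ‖q₀‖ ∧
        q ∉ q ^ n • Literature.AnabelianGeometry.AbsoluteAnabelian.logShell (PadicLogOnUnits.ofUnitLog p K) := by
  rw [hq₀]
  exact cell_realised_both_ways p hnd hϖ hn hpn hs ha₀ hlo hhi ht

end Realisable

end ValuationProfile

end Literature.IUT.LogVolume

end
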